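import Mathlib
import HarnessLib
import Summits.CriticalPhenomena.CardyFormulaZ2.Theses.CardySelfDualSegment
import Literature.Probability.Percolation.CornerPercolation
import Summits.CriticalPhenomena.CardyFormulaZ2.Theorems.CardySelfDualSegmentSegmentOpenSmirnovGermForm
import Summits.CriticalPhenomena.CardyFormulaZ2.Theorems.CardySelfDualSegmentSegmentOpenCruxIffNoIsolated
import Summits.CriticalPhenomena.CardyFormulaZ2.Theorems.CardySelfDualSegmentSegmentClosed

/-!
# Child `GermPropagation` of the r1 split of crux `SegmentOpen` (stmt-CriticalPhenomena-5471) — birth skeleton (plan)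

Strategist r1 (`planner-cstrat-stmt-CriticalPhenomena-5471-r1-0`, 2026-08-17).  `GermPropagation` =
`NearSmirnov → SegmentOpen` (bodies inlined): a good right-neighbourhood of the Smirnov point plus uniform
marginality propagate openness of the good set `G` along the whole segment.  The piece is strictly short of the
summit: it is IMPLIED by identification-free ANALYTICITY of the crossing polynomials plus the sibling crux
`UniformBoxCrossing` (all-`R` form kernel-checked: p131924 `segmentOpen_of_segmentClosed_of_smirnovGerm`, see
`Sketch_r1.lean: germPropagation_of_uniformComplexBound`).  The all-`R` analyticity S4 is very probably false over
WILD Jordan rectangles (comb gadgets, reshape 8 of line `Sketch`), so the plan uses the TAME (polygonal) form: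

* `stub_localComplexBoundPolygonal` (research; S4wR of line `Sketch` extended from rectilinear to POLYGONAL conformal
  rectangles — boundary covered by finitely many segments of any direction — so that the diamond chart domain of S5'
  is admissible; Lee–Yang type, numerically supported with radius ≈ 1 on boxes);
* `stub_uniformBoxCrossing` (= the sibling crux stmt-CriticalPhenomena-5476 BY NAME: t-uniform RSW; needed for
  closedness of `G` via the PROVED `segmentClosed_proof` and to keep the chart modulus inside ℍ);
* `stub_accumulationInteriorOfTameAnalyticity` (provable-now adaptation, size M: S5' `stub_accumulationInteriorGood`
  p125317 with Vitali run on polygonal test domains only — diamond chart `exists_diamond_shear_chart`, S2'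
  `stub_vitaliTransferUniform` per domain, small-mesh patch p131805 — and the identified polygonal limits upgraded
  to every conformal rectangle by (W) `HeatFlow.cardyLimit_of_rectilinear` p137344);
* composition `GermPropagation_of` (PROVED): `G` closed (`segmentClosed_proof` fed by UBC and the UM antecedent),
  accumulation ⇒ interior at good points (stub 3 fed by stub 1), `0` an accumulation point of `G` (from the
  `NearSmirnov` antecedent), clopen sweep `SmirnovGerm.eq_univ_of_isClosed_of_accPt` ⇒ `G = univ`, open.

No jet is identified and nothing is expanded at any point: the kernel K of line `Sketch` (order-1 marginality at
the Smirnov point) enters stub 1 only in its BOUNDEDNESS form (Cauchy estimates), never as convergence /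
identification — those live in the sibling child `NearSmirnov`.
-/

noncomputable section

namespace Summit.CriticalPhenomena.CardyFormulaZ2.Theses.CardySelfDualSegment

/-- child 2 (crux) of the r1 split of `SegmentOpen` (as the gate would render it). -/
def GermPropagation : Prop :=
  let prm : unitInterval → Literature.Probability.LatticeModels.Site 2 × Fin 2 → unitInterval := fun t i => if i.2 = 0 then Literature.Probability.Percolation.half else Literature.Probability.Percolation.half * t; let cfg : Set (Literature.Probability.LatticeModels.Site 2 × Fin 2) → Literature.Probability.Percolation.BondConfig (Literature.Probability.LatticeModels.Site 2) := fun S => {e | ∃ v : Literature.Probability.LatticeModels.Site 2, (e = s(v, v + ![1, 0]) ∧ (v, (0 : Fin 2)) ∈ S) ∨ (e = s(v, v + ![0, 1]) ∧ ((v, (0 : Fin 2)) ∈ S ↔ (v, (1 : Fin 2)) ∉ S))}; let P : unitInterval → Literature.Probability.RandomPlanarGeometry.ConformalRectangle → ℝ → ℝ := fun t R δ => (Literature.Probability.LatticeModels.prodBernoulli (prm t)).real {S | cfg S ∈ Literature.Probability.Percolation.embDomainCrossing Literature.Probability.LatticeModels.squareLatticeEmbedding.z R.carrier δ (R.arc 0)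 (R.arc 2)}; let CardyMod : unitInterval → ℂ → Prop := fun t α => ∀ (R R' : Literature.Probability.RandomPlanarGeometry.ConformalRectangle) (φ : Literature.Probability.RandomPlanarGeometry.ConformalEquiv UpperHalfPlane.upperHalfPlaneSet R.carrier) (x : Fin 4 → ℝ), R.carrier = Literature.Barriers.CriticalPhenomena.moduliShear α '' R'.carrier → (∀ i, R.pt i = Literature.Barriers.CriticalPhenomena.moduliShear α (R'.pt i)) → R.IsUniformizing φ x → Filter.Tendsto (P t R') (nhdsWithin 0 (Set.Ioi 0)) (nhds (Literature.Probability.RandomPlanarGeometry.cardyFunction (Literature.Probability.RandomPlanarGeometry.crossRatio x))); let G : Set unitInterval := {t | ∃ α : ℂ, 0 < α.im ∧ CardyMod t α}; (∃ ε > 0, ∀ t : unitInterval, (t : ℝ) < ε → t ∈ G) → (∀ (t₀ : unitInterval) (R : Literature.Probability.RandomPlanarGeometry.ConformalRectangle) (ε : ℝ), 0 < ε → ∃ η > 0, ∀ t : unitInterval, dist t t₀ < η → ∀ δ : ℝ, 0 < δ → |P t R δ - P t₀ R δ| < ε) → IsOpen G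

end Summit.CriticalPhenomena.CardyFormulaZ2.Theses.CardySelfDualSegment

namespace Summit.CriticalPhenomena.CardyFormulaZ2.Cruxes.SegmentOpen.GermPropagationBirth

open Filter Set Topology
open Literature.Probability Literature.Barriers.CriticalPhenomena
open Literature.Probability.RandomPlanarGeometry (ConformalRectangle ConformalEquiv)
open Summit.CriticalPhenomena.CardyFormulaZ2.Theses.CardySelfDualSegment
open Summit.CriticalPhenomena.CardyFormulaZ2.Theorems

/-- `CardyMod t α` of the route over `Percolation.cornerCrossingProb`. -/
abbrev CardyModAt (t : unitInterval) (α : ℂ) : Prop :=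
  ∀ (R R' : ConformalRectangle)
    (φ : ConformalEquiv UpperHalfPlane.upperHalfPlaneSet R.carrier) (x : Fin 4 → ℝ),
    R.carrier = moduliShear α '' R'.carrier → (∀ i, R.pt i = moduliShear α (R'.pt i)) →
    R.IsUniformizing φ x →
    Tendsto (Percolation.cornerCrossingProb t R') (𝓝[>] 0)
      (𝓝 (RandomPlanarGeometry.cardyFunction (RandomPlanarGeometry.crossRatio x)))

/-- The route's good set. -/
abbrev goodSet : Set unitInterval := {t | ∃ α : ℂ, 0 < α.im ∧ CardyModAt t α}

/-- The route's `UniformMarginality` body. -/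
abbrev UM : Prop :=
  ∀ (t₀ : unitInterval) (R : ConformalRectangle) (ε : ℝ), 0 < ε → ∃ η > 0, ∀ t : unitInterval,
    dist t t₀ < η → ∀ δ : ℝ, 0 < δ →
      |Percolation.cornerCrossingProb t R δ - Percolation.cornerCrossingProb t₀ R δ| < ε

/-- POLYGONAL local mesh-uniform complex bounds (the statement of stub 1, named for reuse). -/
abbrev LocalComplexBoundPolygonal : Prop :=
  ∀ (t₀ : unitInterval) (R : ConformalRectangle),
    (∃ S : Finset (ℂ × ℂ), frontier R.carrier ⊆ ⋃ p ∈ S, segment ℝ p.1 p.2) →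
    ∃ r > 0, ∃ δ₁ > 0, ∃ C : ℝ, ∀ δ : ℝ, 0 < δ → δ < δ₁ → ∀ p : Polynomial ℝ,
      (∀ t : unitInterval, Percolation.cornerCrossingProb t R δ = p.eval (t : ℝ)) →
      ∀ z ∈ Metric.ball ((t₀ : ℝ) : ℂ) r, ‖(p.map (algebraMap ℝ ℂ)).eval z‖ ≤ C

/-! ## Stubs -/

/-- Stub 1 (research).  LOCAL MESH-UNIFORM ANALYTICITY ON POLYGONAL TEST DOMAINS: for each `t₀ ∈ [0,1]` and each
conformal rectangle whose boundary is covered by finitely many straight segments there are a complex radius `r`, a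
mesh threshold `δ₁` and a bound `C` with `|p_δ(z)| ≤ C` on `B(t₀, r)` for all crossing polynomials `p_δ`, `δ < δ₁`.
(S4wR of line `Sketch` is the rectilinear sub-case; the wild-boundary counterexamples to the all-`R` form are not
polygonal.) -/
theorem stub_localComplexBoundPolygonal : LocalComplexBoundPolygonal := by
  sorry

/-- Stub 2 = the sibling crux `UniformBoxCrossing` (stmt-CriticalPhenomena-5476) BY NAME: the t-uniform box-crossing
property of the corner family. -/
theorem stub_uniformBoxCrossing : UniformBoxCrossing := by
  sorry

/-- Stub 3 (provable-now adaptation of S5' p125317, size M).  ACCUMULATION ⇒ INTERIOR AT GOOD POINTS FROM TAME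
ANALYTICITY: under stub 1, every good point of `G` that is an accumulation point of `G` is an interior point of `G`
(Vitali on polygonal test domains incl. the diamond chart domain; analytic local inverse of the chart; identity
theorem; (W) transport from rectilinear to all conformal rectangles). -/
theorem stub_accumulationInteriorOfTameAnalyticity :
    LocalComplexBoundPolygonal →
      ∀ t₀ ∈ goodSet, AccPt t₀ (𝓟 goodSet) → t₀ ∈ interior goodSet := by
  sorry

/-! ## Composition (proved) -/

theorem germPropagation_iff :
    GermPropagation ↔ ((∃ ε > 0, ∀ t : unitInterval, (t : ℝ) < ε → t ∈ goodSet) → UM → IsOpen goodSet) :=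
  Iff.rfl

/-- A right-neighbourhood of `0` inside `G` makes `0` an accumulation point of `G`. -/
theorem accPt_zero_of_near (h : ∃ ε > 0, ∀ t : unitInterval, (t : ℝ) < ε → t ∈ goodSet) :
    AccPt (0 : unitInterval) (𝓟 goodSet) := by
  obtain ⟨ε, hε, hG⟩ := h
  have hopen : IsOpen {t : unitInterval | (t : ℝ) < ε} :=
    isOpen_lt continuous_subtype_val continuous_const
  have h0 : (0 : unitInterval) ∈ {t : unitInterval | (t : ℝ) < ε} := by simpa using hε
  exact (accPt_principal_of_isOpen_unitInterval hopen h0).mono (principal_mono.2 fun t ht => hG t ht)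

/-- **COMPOSITION: stub 1 → stub 2 → stub 3 → `GermPropagation`.**  `G` is closed (proved `segmentClosed_proof` fed
by `UniformBoxCrossing` and the marginality antecedent), accumulation points of `G` in `G` are interior (stub 3 fed
by stub 1), and `0` is an accumulation point of `G` (the `NearSmirnov` antecedent); the clopen sweep
`SmirnovGerm.eq_univ_of_isClosed_of_accPt` gives `G = [0,1]`, which is open. -/
theorem GermPropagation_of :
    LocalComplexBoundPolygonal → UniformBoxCrossing →
      (LocalComplexBoundPolygonal → ∀ t₀ ∈ goodSet, AccPt t₀ (𝓟 goodSet) → t₀ ∈ interior goodSet) →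
      GermPropagation := by
  intro h1 hX h3
  rw [germPropagation_iff]
  intro hnear hUM
  have hcl : IsClosed goodSet := (segmentClosed_iff.1 segmentClosed_proof) hX hUM
  have huniv : goodSet = univ :=
    SmirnovGerm.eq_univ_of_isClosed_of_accPt hcl (fun t ht hacc => h3 h1 t ht hacc) (accPt_zero_of_near hnear)
  rw [huniv]
  exact isOpen_univ

/-- The registered-stub form: the three stubs close the child. -/
theorem GermPropagation_of_stubs : GermPropagation :=
  GermPropagation_of stub_localComplexBoundPolygonal stub_uniformBoxCrossing
    stub_accumulationInteriorOfTameAnalyticity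

end Summit.CriticalPhenomena.CardyFormulaZ2.Cruxes.SegmentOpen.GermPropagationBirth
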